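import Summits.AtomisticToContinuum.Crystallization.Theorems.DisclinationRationUniformPolytypeStabilityGapPinningSums
import Summits.AtomisticToContinuum.Crystallization.Theorems.DisclinationRationUniformPolytypeStabilitySites

/-!
# `UniformPolytypeStability` (stmt-AtomisticToContinuum-15800), line `birth` (v2, cells): stub `stub_gapPinning`, part 3 (layer-pair forces)

Route `DisclinationRation`, crux `UniformPolytypeStability`, line `birth` (lead prover-line-stmt-AtomisticToContinuum-15800-0).
Step (B0a) of the idea card `constant-stress-gap-pinning`: the crux's per-site force balance, read in its third
component and regrouped by layers along the index picture `pos : Idx ≃ Sites a s z` of `stub_sites`, is the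
conservation law `Σ_i lf a s z i ℓ = 0` for every layer `ℓ`, where `lf a s z i j` (definitions file
`…GapPinningDefs`) is the normal force per site that layer `i` exerts on layer `j`:

* `V′(r)/r = psi (r²)` and `dist(pos (ℓ,0,0), pos (i,u,v))² = a² Qf (c_i − c_ℓ) (u,v) + (z i − z ℓ)²`;
* `hasSum_lf`: `ForceBalanced a s z → HasSum (fun i ↦ lf a s z i ℓ) 0` (the `HasSum` of the crux is absolutely
  summable for free; `HasSum.prod_fiberwise` does the regrouping);
* `lf_swap` (action = −reaction, by the point reflection of `ℤ²`), `lf_self`, `lf_eq_calG`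
  (`lf i j = calG (c_i − c_j) a ((z j − z i)/a)`), and the decay `|calG c a η| ≤ η a⁻⁷ Alat 4 c η ≤ 52 a⁻⁷ η⁻⁵`
  that makes the transmitted stress absolutely convergent (part 4).

Everything is `[folklore]`; theorem-only file; nothing here closes an item.  `stub_gapPinningAux3` is the registered anchor.
-/

noncomputable section

namespace Summit.AtomisticToContinuum.Crystallization.Theorems.UniformPolytypeStabilityCells

namespace StubGapPinning

open scoped BigOperators
open Literature.MathematicalPhysics.StatisticalMechanics
open Summit.AtomisticToContinuum.Crystallization.Theorems.PhononStabilityNegative (deriv_lennardJones)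

/-! ## The pair kernel and the layer geometry -/

/-- `V′(r)/r = psi (r²)` for `r ≠ 0`. [folklore] -/
theorem deriv_lennardJones_div (r : ℝ) (hr : r ≠ 0) : deriv lennardJones r / r = psi (r ^ 2) := by
  rw [deriv_lennardJones hr, psi, inv_pow, inv_pow, inv_pow, inv_pow, ← pow_mul, ← pow_mul]
  field_simp
  ring

/-- Squared distance from the site `(ℓ,0,0)` to the site `(i,u,v)`:
`a² · Qf (c_i − c_ℓ) (u,v) + (z ℓ − z i)²`. [folklore] -/
theorem dist_sq_layer (a : ℝ) (s : ℤ → ℤ) (z : ℤ → ℝ) (ℓ i : ℤ) (p : ℤ × ℤ) :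
    dist (pos a s z (ℓ, 0, 0)) (pos a s z (i, p.1, p.2)) ^ 2 =
      a ^ 2 * (Qf (haggLabel s i - haggLabel s ℓ) p : ℝ) + (z ℓ - z i) ^ 2 := by
  rw [StubSites.dist_pos_sq, Qf]
  push_cast
  ring

/-- The summand of `lf`, as a function on `ℤ × ℤ`. [folklore] -/
theorem lf_eq (a : ℝ) (s : ℤ → ℤ) (z : ℤ → ℝ) (i j : ℤ) : lf a s z i j = (z j - z i) *
    ∑' p : ℤ × ℤ, psi (a ^ 2 * (Qf (haggLabel s i - haggLabel s j) p : ℝ) + (z j - z i) ^ 2) := rfl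

/-- `lf i i = 0` (no self-force across a layer). [folklore] -/
theorem lf_self (a : ℝ) (s : ℤ → ℤ) (z : ℤ → ℝ) (i : ℤ) : lf a s z i i = 0 := by
  simp [lf]

/-- Action = −reaction: `lf j i = −lf i j` (point reflection `p ↦ −p` of the in-plane indices). [folklore] -/
theorem lf_swap (a : ℝ) (s : ℤ → ℤ) (z : ℤ → ℝ) (i j : ℤ) : lf a s z j i = -lf a s z i j := by
  rw [lf, lf, neg_mul_eq_neg_mul, neg_sub]
  congr 1
  rw [← (Equiv.neg (ℤ × ℤ)).tsum_eq fun p : ℤ × ℤ =>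
      psi (a ^ 2 * (Qf (haggLabel s i - haggLabel s j) p : ℝ) + (z j - z i) ^ 2)]
  refine tsum_congr fun p => ?_
  obtain ⟨u, v⟩ := p
  have hQ : ((Qf (haggLabel s j - haggLabel s i) (u, v) : ℚ) : ℝ) =
      Qf (haggLabel s i - haggLabel s j) (-u, -v) := by
    simp only [Qf]; push_cast; ring
  simp only [Equiv.neg_apply, Prod.neg_mk]
  rw [hQ]
  ring_nf

/-! ## The layer-pair force is the lattice sum `calG` -/

/-- `lf i j = calG (c_i − c_j) a ((z j − z i)/a)` for `a > 0`. [folklore] -/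
theorem lf_eq_calG {a : ℝ} (ha : 0 < a) (s : ℤ → ℤ) (z : ℤ → ℝ) (i j : ℤ) :
    lf a s z i j = calG (haggLabel s i - haggLabel s j) a ((z j - z i) / a) := by
  rw [lf, calG]
  set c : ℤ := haggLabel s i - haggLabel s j
  set η : ℝ := (z j - z i) / a with hη
  have hD : z j - z i = a * η := by rw [hη]; field_simp
  have h4 := summable_term (k := 4) (by norm_num) c η
  have h7 := summable_term (k := 7) (by norm_num) c η
  have hterm : ∀ p : ℤ × ℤ, psi (a ^ 2 * (Qf c p : ℝ) + (z j - z i) ^ 2) =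
      (a⁻¹) ^ 8 * ((Qf c p : ℝ) + η ^ 2)⁻¹ ^ 4 - (a⁻¹) ^ 14 * ((Qf c p : ℝ) + η ^ 2)⁻¹ ^ 7 := by
    intro p
    rw [hD, psi, show a ^ 2 * (Qf c p : ℝ) + (a * η) ^ 2 = a ^ 2 * ((Qf c p : ℝ) + η ^ 2) by ring,
      mul_inv, mul_pow, mul_pow, show (a ^ 2)⁻¹ = a⁻¹ ^ 2 by rw [inv_pow], ← pow_mul, ← pow_mul]
    ring
  simp_rw [hterm]
  rw [(h4.mul_left _).tsum_sub (h7.mul_left _), tsum_mul_left, tsum_mul_left, hD, Alat, Alat]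
  have ha' : a ≠ 0 := ha.ne'
  field_simp

/-- The adjacent-layer force is the class-`1` lattice sum: `lf m (m+1) = calG 1 a η_m` (`s m = ±1`). [folklore] -/
theorem lf_succ_eq {a : ℝ} (ha : 0 < a) {s : ℤ → ℤ} (hs : IsHaggSeq s) (z : ℤ → ℝ) (m : ℤ) :
    lf a s z m (m + 1) = calG 1 a (etaG a z m) := by
  rw [lf_eq_calG ha, calG, calG, Alat_cls 4, Alat_cls 7, etaG, gap]
  have hc : haggLabel s m - haggLabel s (m + 1) = -s m := by rw [haggLabel_succ]; ring
  have hc' : cls (-s m) = 1 := by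
    rcases hs m with h | h <;> rw [h] <;> decide
  rw [hc, hc']

/-! ## Decay of the layer-pair force -/

/-- `|calG c a η| ≤ η a⁻⁷ Alat 4 c η` for `0 < a ≤ 1`, `η ≥ a⁻¹` (the `r⁻¹³` part is dominated termwise). [folklore] -/
theorem abs_calG_le {c : ℤ} {a η : ℝ} (ha : 0 < a) (ha1 : a ≤ 1) (hη : a⁻¹ ≤ η) :
    |calG c a η| ≤ η * (a⁻¹) ^ 7 * Alat 4 c η := by
  have hainv : 1 ≤ a⁻¹ := one_le_inv_iff₀.2 ⟨ha, ha1⟩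
  have hηpos : 0 < η := lt_of_lt_of_le (by positivity) hη
  have h4 := summable_term (k := 4) (by norm_num) c η
  have h7 := summable_term (k := 7) (by norm_num) c η
  -- termwise: a⁻¹³ x⁷ ≤ a⁻⁷ x⁴ for 0 ≤ x ≤ η⁻² ≤ a²
  have hdom : (a⁻¹) ^ 13 * Alat 7 c η ≤ (a⁻¹) ^ 7 * Alat 4 c η := by
    rw [Alat, Alat, ← tsum_mul_left, ← tsum_mul_left]
    refine (h7.mul_left _).tsum_le_tsum (fun p => ?_) (h4.mul_left _)
    set x : ℝ := ((Qf c p : ℝ) + η ^ 2)⁻¹ with hx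
    have hx0 : 0 ≤ x := inv_nonneg.2 (by nlinarith [Qf_nonneg c p])
    have hxη : x ≤ (η ^ 2)⁻¹ := inv_anti₀ (by positivity) (by nlinarith [Qf_nonneg c p])
    have hηa : (η ^ 2)⁻¹ ≤ a ^ 2 := by
      rw [inv_le_comm₀ (by positivity) (by positivity), ← inv_pow]; exact pow_le_pow_left₀ (by positivity) hη 2
    have hxa : x * a⁻¹ ^ 2 ≤ 1 := by
      have : x ≤ a ^ 2 := hxη.trans hηa
      calc x * a⁻¹ ^ 2 ≤ a ^ 2 * a⁻¹ ^ 2 := mul_le_mul_of_nonneg_right this (by positivity)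
        _ = 1 := by rw [← mul_pow, mul_inv_cancel₀ ha.ne', one_pow]
    have hxa3 : (x * a⁻¹ ^ 2) ^ 3 ≤ 1 := pow_le_one₀ (by positivity) hxa
    calc (a⁻¹) ^ 13 * x ^ 7 = (a⁻¹) ^ 7 * x ^ 4 * (x * a⁻¹ ^ 2) ^ 3 := by ring
      _ ≤ (a⁻¹) ^ 7 * x ^ 4 * 1 := mul_le_mul_of_nonneg_left hxa3 (by positivity)
      _ = (a⁻¹) ^ 7 * x ^ 4 := mul_one _
  have hlo : 0 ≤ (a⁻¹) ^ 7 * Alat 4 c η - (a⁻¹) ^ 13 * Alat 7 c η := sub_nonneg.2 hdom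
  have hhi : (a⁻¹) ^ 7 * Alat 4 c η - (a⁻¹) ^ 13 * Alat 7 c η ≤ (a⁻¹) ^ 7 * Alat 4 c η :=
    sub_le_self _ (mul_nonneg (by positivity) (Alat_nonneg 7 c η))
  rw [calG, abs_mul, abs_of_pos hηpos, abs_of_nonneg hlo, mul_assoc]
  exact mul_le_mul_of_nonneg_left hhi hηpos.le

/-- Crude decay `|calG c a η| ≤ 52 a⁻⁷ η⁻⁵` for `0 < a ≤ 1`, `η ≥ 1`, `η ≥ a⁻¹`. [folklore] -/
theorem abs_calG_le_inv_pow (c : ℤ) {a η : ℝ} (ha : 0 < a) (ha1 : a ≤ 1) (hη1 : 1 ≤ η) (hη : a⁻¹ ≤ η) :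
    |calG c a η| ≤ 52 * (a⁻¹) ^ 7 * (η⁻¹) ^ 5 := by
  have hηpos : 0 < η := by linarith
  have h1 := abs_calG_le (c := c) ha ha1 hη
  rw [Alat_cls] at h1
  have h2 := Alat_four_le (abs_cls_le c) hηpos
  have hinv1 : η⁻¹ ≤ 1 := inv_le_one_of_one_le₀ hη1
  have hinv0 : 0 ≤ η⁻¹ := inv_nonneg.2 hηpos.le
  have h3 : Alat 4 (cls c) η ≤ 52 * (η⁻¹) ^ 6 := by
    have : (η⁻¹) ^ 8 ≤ (η⁻¹) ^ 6 := pow_le_pow_of_le_one hinv0 hinv1 (by norm_num)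
    have h6 : 0 ≤ (η⁻¹) ^ 6 := pow_nonneg hinv0 6
    linarith
  calc |calG c a η| ≤ η * (a⁻¹) ^ 7 * Alat 4 (cls c) η := h1
    _ ≤ η * (a⁻¹) ^ 7 * (52 * (η⁻¹) ^ 6) := mul_le_mul_of_nonneg_left h3 (by positivity)
    _ = 52 * (a⁻¹) ^ 7 * (η⁻¹) ^ 5 * (η * η⁻¹) := by ring
    _ = 52 * (a⁻¹) ^ 7 * (η⁻¹) ^ 5 := by rw [mul_inv_cancel₀ hηpos.ne', mul_one]

/-! ## Force balance ⇒ the layer sums of `lf` vanish -/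

variable {a : ℝ} {s : ℤ → ℤ} {z : ℤ → ℝ}

/-- The third component of the force term of the crux at the site `(ℓ,0,0)` against the site `x`, as a function of
the index: `psi(dist²) · (z ℓ − z x.1)`; it vanishes at `x = (ℓ,0,0)` by the factor `z ℓ − z ℓ`. [folklore] -/
theorem forceTerm_two (hinj : Function.Injective (pos a s z)) (ℓ : ℤ) (x : Idx) :
    deriv lennardJones (dist (pos a s z (ℓ, 0, 0)) (pos a s z x)) / dist (pos a s z (ℓ, 0, 0)) (pos a s z x) *
        ((pos a s z (ℓ, 0, 0) - pos a s z x) 2) =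
      psi (a ^ 2 * (Qf (haggLabel s x.1 - haggLabel s ℓ) x.2 : ℝ) + (z ℓ - z x.1) ^ 2) * (z ℓ - z x.1) := by
  obtain ⟨i, p⟩ := x
  have hz : (pos a s z (ℓ, 0, 0) - pos a s z (i, p)) 2 = z ℓ - z i := by
    rw [PiLp.sub_apply, StubSites.pos_apply_two, StubSites.pos_apply_two]
  rw [hz]
  by_cases hx : ((i, p) : Idx) = (ℓ, 0, 0)
  · have hi : i = ℓ := (Prod.ext_iff.1 hx).1
    simp [hi]
  · have hd : dist (pos a s z (ℓ, 0, 0)) (pos a s z (i, p)) ≠ 0 :=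
      dist_ne_zero.2 fun h => hx (hinj h).symm
    rw [deriv_lennardJones_div _ hd, show ((i, p) : Idx) = (i, p.1, p.2) from rfl, dist_sq_layer]

/-- **(B0a) Force balance, third component, regrouped by layers**: `Σ_i lf a s z i ℓ = 0` as a `HasSum`. [folklore] -/
theorem hasSum_lf (ha : 47 / 50 ≤ a) (ha1 : a ≤ 1) (hs : IsHaggSeq s) (hz : HeightBox a z)
    (hF : ForceBalanced a s z) (ℓ : ℤ) : HasSum (fun i : ℤ => lf a s z i ℓ) 0 := by
  obtain ⟨hinj, hrange, -, -, -⟩ := stub_sites a s z ha ha1 hs hz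
  have hmemS : ∀ x, pos a s z x ∈ Sites a s z := fun x => by rw [← hrange]; exact ⟨x, rfl⟩
  have hsurj : ∀ q ∈ Sites a s z, ∃ x, pos a s z x = q := fun q hq => by rwa [← hrange] at hq
  set x₀ : Idx := (ℓ, 0, 0) with hx₀
  set p₀ : EuclideanSpace ℝ (Fin 3) := pos a s z x₀ with hp₀
  have hp₀S : p₀ ∈ Sites a s z := hmemS x₀
  -- the force term as a function of the index
  set G : Idx → ℝ := fun x =>
    deriv lennardJones (dist p₀ (pos a s z x)) / dist p₀ (pos a s z x) * ((p₀ - pos a s z x) 2) with hG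
  -- transport the crux's `HasSum` along `pos`
  have hmem : ∀ x : {x : Idx // x ∈ ({x | x ≠ x₀} : Set Idx)}, pos a s z x.1 ∈ Sites a s z ∧ pos a s z x.1 ≠ p₀ :=
    fun x => ⟨hmemS x.1, fun h => x.2 (hinj h)⟩
  set e : {x : Idx // x ∈ ({x | x ≠ x₀} : Set Idx)} → {q : EuclideanSpace ℝ (Fin 3) // q ∈ Sites a s z ∧ q ≠ p₀} :=
    fun x => ⟨pos a s z x.1, hmem x⟩ with he
  have hbij : Function.Bijective e := by
    refine ⟨fun x y hxy => Subtype.ext (hinj (congrArg Subtype.val hxy)), fun q => ?_⟩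
    obtain ⟨x, hx⟩ := hsurj q.1 q.2.1
    exact ⟨⟨x, fun h => q.2.2 (by rw [← hx, h])⟩, Subtype.ext hx⟩
  have h1 : HasSum (fun q : {q : EuclideanSpace ℝ (Fin 3) // q ∈ Sites a s z ∧ q ≠ p₀} =>
      deriv lennardJones (dist p₀ q.1) / dist p₀ q.1 * ((p₀ - q.1) 2)) 0 := by
    have h := (hF p₀ hp₀S).mapL (EuclideanSpace.proj (2 : Fin 3))
    simpa using h
  have h2 : HasSum (G ∘ ((↑) : ({x | x ≠ x₀} : Set Idx) → Idx)) 0 :=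
    (Equiv.ofBijective e hbij).hasSum_iff.2 h1
  have hsupp : Function.support G ⊆ {x | x ≠ x₀} := by
    intro x hx h
    apply hx
    simp [hG, h, hp₀]
  have h3 : HasSum G 0 := (hasSum_subtype_iff_of_support_subset hsupp).1 h2
  -- regroup by layers
  have h4 : HasSum (fun i : ℤ => ∑' p : ℤ × ℤ, G (i, p)) 0 :=
    h3.prod_fiberwise fun i => (h3.summable.prod_factor i).hasSum
  refine h4.congr_fun fun i => ?_
  simp only [hG, hp₀, hx₀, forceTerm_two hinj, tsum_mul_right, lf]
  rw [mul_comm]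

/-! ## Rows of the transmitted stress -/

/-- Row `0` is empty. [folklore] -/
theorem row_zero (a : ℝ) (s : ℤ → ℤ) (z : ℤ → ℝ) (m : ℤ) : row a s z m 0 = 0 := by simp [row]

/-- Row `1` is the adjacent-layer force `lf m (m+1)`. [folklore] -/
theorem row_one (a : ℝ) (s : ℤ → ℤ) (z : ℤ → ℝ) (m : ℤ) : row a s z m 1 = lf a s z m (m + 1) := by
  simp [row]

/-- The reduced height of a level-`t` pair is at least `39t/50` on the box. [folklore] -/
theorem le_height_div (ha : 0 < a) (hz : HeightBox a z) (i : ℤ) (t : ℕ) :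
    39 * (t : ℝ) / 50 ≤ (z (i + t) - z i) / a := by
  rw [le_div_iff₀ ha]
  have := StubSites.mul_le_height_sub a z hz i t
  linarith

/-- Decay of a single pair at level `t ≥ 3`: `|lf i (i+t)| ≤ 52 (50/39)⁵ a⁻⁷ t⁻⁵`. [folklore] -/
theorem abs_lf_le (ha : 47 / 50 ≤ a) (ha1 : a ≤ 1) (hz : HeightBox a z) (i : ℤ) {t : ℕ} (ht : 3 ≤ t) :
    |lf a s z i (i + t)| ≤ 52 * (50 / 39) ^ 5 * (a⁻¹) ^ 7 * ((t : ℝ)⁻¹) ^ 5 := by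
  have ha0 : 0 < a := by linarith
  have ht' : (3 : ℝ) ≤ t := by exact_mod_cast ht
  set η : ℝ := (z (i + t) - z i) / a with hη
  have hη1 : 39 * (t : ℝ) / 50 ≤ η := le_height_div ha0 hz i t
  have hηpos : 0 < η := by linarith
  have hainv : a⁻¹ ≤ η := by
    have : a⁻¹ ≤ 50 / 47 := by rw [inv_le_comm₀ ha0 (by norm_num)]; norm_num; linarith
    linarith
  rw [lf_eq_calG ha0]
  refine (abs_calG_le_inv_pow _ ha0 ha1 (by linarith) hainv).trans ?_
  have h1 : η⁻¹ ≤ 50 / 39 * (t : ℝ)⁻¹ := by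
    rw [inv_le_comm₀ hηpos (by positivity), mul_inv, inv_inv]; linarith
  have h2 : (η⁻¹) ^ 5 ≤ (50 / 39 * (t : ℝ)⁻¹) ^ 5 := pow_le_pow_left₀ (inv_nonneg.2 hηpos.le) h1 5
  calc 52 * (a⁻¹) ^ 7 * (η⁻¹) ^ 5 ≤ 52 * (a⁻¹) ^ 7 * (50 / 39 * (t : ℝ)⁻¹) ^ 5 :=
        mul_le_mul_of_nonneg_left h2 (by positivity)
    _ = 52 * (50 / 39) ^ 5 * (a⁻¹) ^ 7 * ((t : ℝ)⁻¹) ^ 5 := by ring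

/-- Decay of the rows: `|row m t| ≤ 52 (50/39)⁵ a⁻⁷ t⁻⁴` for `t ≥ 3`. [folklore] -/
theorem abs_row_le (ha : 47 / 50 ≤ a) (ha1 : a ≤ 1) (hz : HeightBox a z) (m : ℤ) {t : ℕ} (ht : 3 ≤ t) :
    |row a s z m t| ≤ 52 * (50 / 39) ^ 5 * (a⁻¹) ^ 7 * ((t : ℝ)⁻¹) ^ 4 := by
  have ht0 : (0 : ℝ) < t := by exact_mod_cast (show 0 < t by omega)
  rw [row]
  refine (Finset.abs_sum_le_sum_abs _ _).trans ?_
  calc ∑ k ∈ Finset.range t, |lf a s z (m - k) (m - k + t)|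
      ≤ ∑ _k ∈ Finset.range t, 52 * (50 / 39) ^ 5 * (a⁻¹) ^ 7 * ((t : ℝ)⁻¹) ^ 5 :=
        Finset.sum_le_sum fun k _ => abs_lf_le ha ha1 hz (m - k) ht
    _ = 52 * (50 / 39) ^ 5 * (a⁻¹) ^ 7 * ((t : ℝ)⁻¹) ^ 4 := by
        rw [Finset.sum_const, Finset.card_range, nsmul_eq_mul]; field_simp

/-- The rows are absolutely summable in `t`. [folklore] -/
theorem summable_row (ha : 47 / 50 ≤ a) (ha1 : a ≤ 1) (hz : HeightBox a z) (m : ℤ) :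
    Summable (row a s z m) := by
  have hg : Summable fun t : ℕ => 52 * (50 / 39 : ℝ) ^ 5 * (a⁻¹) ^ 7 * ((t : ℝ) ^ 4)⁻¹ :=
    (Real.summable_nat_pow_inv.2 (by norm_num)).mul_left _
  refine Summable.of_norm_bounded_eventually_nat hg ?_
  filter_upwards [Filter.eventually_ge_atTop 3] with t ht
  rw [Real.norm_eq_abs, ← inv_pow]
  exact abs_row_le ha ha1 hz m ht

/-! ## (B0b) The transmitted stress is constant -/

/-- Row difference across one layer: `row (m+1) (n+1) − row m (n+1) = lf (m+1) (m+2+n) − lf (m−n) (m+1)`. [folklore] -/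
theorem row_succ_sub (a : ℝ) (s : ℤ → ℤ) (z : ℤ → ℝ) (m : ℤ) (n : ℕ) :
    row a s z (m + 1) (n + 1) - row a s z m (n + 1) =
      lf a s z (m + 1) (m + 1 + ((n : ℤ) + 1)) - lf a s z (m + 1 + -((n : ℤ) + 1)) (m + 1) := by
  rw [row, row, Finset.sum_range_succ', Finset.sum_range_succ]
  have h1 : ∀ k ∈ Finset.range n, lf a s z (m + 1 - ((k + 1 : ℕ) : ℤ)) (m + 1 - ((k + 1 : ℕ) : ℤ) + ((n + 1 : ℕ) : ℤ)) =
      lf a s z (m - (k : ℤ)) (m - (k : ℤ) + ((n + 1 : ℕ) : ℤ)) := by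
    intro k _; congr 1 <;> push_cast <;> ring
  have h2 : lf a s z (m + 1 - ((0 : ℕ) : ℤ)) (m + 1 - ((0 : ℕ) : ℤ) + ((n + 1 : ℕ) : ℤ)) =
      lf a s z (m + 1) (m + 1 + ((n : ℤ) + 1)) := by congr 1 <;> push_cast <;> ring
  have h3 : lf a s z (m - (n : ℤ)) (m - (n : ℤ) + ((n + 1 : ℕ) : ℤ)) = lf a s z (m + 1 + -((n : ℤ) + 1)) (m + 1) := by
    congr 1 <;> push_cast <;> ring
  rw [Finset.sum_congr rfl h1, h2, h3]
  ring

/-- The recentred layer balance at `ℓ` splits into the layers above and below `ℓ`: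
`Σ_{n} lf (ℓ+n+1) ℓ + Σ_{n} lf (ℓ−n−1) ℓ = 0`, both series absolutely convergent. [folklore] -/
theorem tsum_lf_above_add_below (ha : 47 / 50 ≤ a) (ha1 : a ≤ 1) (hs : IsHaggSeq s) (hz : HeightBox a z)
    (hF : ForceBalanced a s z) (ℓ : ℤ) :
    Summable (fun n : ℕ => lf a s z (ℓ + ((n : ℤ) + 1)) ℓ) ∧ Summable (fun n : ℕ => lf a s z (ℓ + -((n : ℤ) + 1)) ℓ) ∧
      ∑' n : ℕ, lf a s z (ℓ + ((n : ℤ) + 1)) ℓ + ∑' n : ℕ, lf a s z (ℓ + -((n : ℤ) + 1)) ℓ = 0 := by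
  have h : HasSum (fun d : ℤ => lf a s z (ℓ + d) ℓ) 0 := by
    simpa [Function.comp_def] using (Equiv.addLeft ℓ).hasSum_iff.2 (hasSum_lf ha ha1 hs hz hF ℓ)
  have hinj1 : Function.Injective fun n : ℕ => (n : ℤ) + 1 := fun x y h => by simpa using h
  have hinj2 : Function.Injective fun n : ℕ => -((n : ℤ) + 1) := fun x y h => by simpa using h
  have hS1 : Summable fun n : ℕ => lf a s z (ℓ + ((n : ℤ) + 1)) ℓ := h.summable.comp_injective hinj1
  have hS2 : Summable fun n : ℕ => lf a s z (ℓ + -((n : ℤ) + 1)) ℓ := h.summable.comp_injective hinj2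
  refine ⟨hS1, hS2, ?_⟩
  have hsplit := tsum_of_add_one_of_neg_add_one (f := fun d : ℤ => lf a s z (ℓ + d) ℓ) hS1 hS2
  rw [h.tsum_eq] at hsplit
  simp only [add_zero, lf_self] at hsplit
  linarith

/-- **(B0b)** Under force balance the transmitted normal stress does not depend on the plane:
`Pst (m+1) = Pst m`. [folklore] -/
theorem Pst_succ (ha : 47 / 50 ≤ a) (ha1 : a ≤ 1) (hs : IsHaggSeq s) (hz : HeightBox a z)
    (hF : ForceBalanced a s z) (m : ℤ) : Pst a s z (m + 1) = Pst a s z m := by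
  have hs1 := summable_row (s := s) ha ha1 hz (m + 1)
  have hs0 := summable_row (s := s) ha ha1 hz m
  have hd : Summable fun t => row a s z (m + 1) t - row a s z m t := hs1.sub hs0
  rw [Pst, Pst, ← sub_eq_zero, ← hs1.tsum_sub hs0, hd.tsum_eq_zero_add]
  simp only [row_zero, sub_self, zero_add, row_succ_sub]
  have hanti : ∀ n : ℕ, lf a s z (m + 1) (m + 1 + ((n : ℤ) + 1)) = -lf a s z (m + 1 + ((n : ℤ) + 1)) (m + 1) :=
    fun n => lf_swap a s z _ _
  simp_rw [hanti]
  obtain ⟨hS1, hS2, hsum⟩ := tsum_lf_above_add_below ha ha1 hs hz hF (m + 1)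
  rw [hS1.neg.tsum_sub hS2, tsum_neg]
  linarith

/-- `Pst m = Pst m'` for all planes. [folklore] -/
theorem Pst_eq (ha : 47 / 50 ≤ a) (ha1 : a ≤ 1) (hs : IsHaggSeq s) (hz : HeightBox a z)
    (hF : ForceBalanced a s z) (m m' : ℤ) : Pst a s z m = Pst a s z m' := by
  suffices h : ∀ m : ℤ, Pst a s z m = Pst a s z 0 by rw [h m, h m']
  intro m
  induction m using Int.induction_on with
  | zero => rfl
  | succ m ih => rw [Pst_succ ha ha1 hs hz hF, ih]
  | pred m ih => rw [← ih, ← Pst_succ ha ha1 hs hz hF (-(m : ℤ) - 1), sub_add_cancel]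

/-- **The conservation law in the form the bootstrap consumes**: the adjacent-layer forces of two planes differ by
minus the difference of their far rows, `lf m (m+1) − lf m' (m'+1) = −Σ_{n} (row m (n+2) − row m' (n+2))`, the series
being absolutely convergent. [folklore] -/
theorem lf_succ_sub_eq (ha : 47 / 50 ≤ a) (ha1 : a ≤ 1) (hs : IsHaggSeq s) (hz : HeightBox a z)
    (hF : ForceBalanced a s z) (m m' : ℤ) :
    Summable (fun n : ℕ => row a s z m (n + 2) - row a s z m' (n + 2)) ∧
      lf a s z m (m + 1) - lf a s z m' (m' + 1) = -∑' n : ℕ, (row a s z m (n + 2) - row a s z m' (n + 2)) := by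
  have hsm := summable_row (s := s) ha ha1 hz m
  have hsm' := summable_row (s := s) ha ha1 hz m'
  have hd : Summable fun t => row a s z m t - row a s z m' t := hsm.sub hsm'
  have hd1 : Summable fun n : ℕ => row a s z m (n + 1) - row a s z m' (n + 1) :=
    (summable_nat_add_iff (f := fun t => row a s z m t - row a s z m' t) 1).2 hd
  have hd2 : Summable fun n : ℕ => row a s z m (n + 2) - row a s z m' (n + 2) :=
    (summable_nat_add_iff (f := fun t => row a s z m t - row a s z m' t) 2).2 hd
  refine ⟨hd2, ?_⟩
  have h0 : ∑' t, (row a s z m t - row a s z m' t) = 0 := by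
    rw [hsm.tsum_sub hsm', ← Pst, ← Pst, Pst_eq ha ha1 hs hz hF m m', sub_self]
  rw [hd.tsum_eq_zero_add, hd1.tsum_eq_zero_add] at h0
  simp only [row_zero, sub_self, zero_add, row_one] at h0
  linarith

end StubGapPinning

/-- Registered anchor `stub_gapPinningAux3` of the layer-force file of `stub_gapPinning`: action = −reaction for
the layer-pair forces and no self-force. [folklore] -/
theorem stub_gapPinningAux3 : ∀ (a : ℝ) (s : ℤ → ℤ) (z : ℤ → ℝ) (i j : ℤ),
    StubGapPinning.lf a s z j i = -StubGapPinning.lf a s z i j ∧ StubGapPinning.lf a s z i i = 0 :=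
  fun a s z i j => ⟨StubGapPinning.lf_swap a s z i j, StubGapPinning.lf_self a s z i⟩

end Summit.AtomisticToContinuum.Crystallization.Theorems.UniformPolytypeStabilityCells

end
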